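import Summits.CriticalPhenomena.PercolationContinuityZ3.Theorems.Transplant.FKConnectivityAllQAntipodalRootForm
import Summits.CriticalPhenomena.PercolationContinuityZ3.Theorems.Transplant.FKConnectivityAllQAntipodalRootFormCert

/-!
# Connectivity correlation inequalities for `φ_{w,q}`, every `q > 0` — ROOT-FORM CALCULUS, file 61e: abstract one-special boxes, the pair
# environment `B_y ∥ B_z`, and THEOREM G27 (♣ ≥ 0) from the kernel-checked certificate

Support file (`--supports stmt-CriticalPhenomena-4575`), FK sub-lane `prim-bschramm-fk-2` (gen 28); builds on p205010 (kernel theorem, internal audit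
signed; external expert review pending).  Standard axioms, no sorries.  Memos FROM-fk-2-g27-ONEEAR-NF.md §4, FROM-fk-2-g28-ROOT-FORM.md §6–§7.

An abstract one-special box over a configuration type `B` is a map `B → BDat` (level and pole bits at the two states of the special); two boxes in
parallel between common poles give the environment `thetaPair Y Z : Env (B × B')` of file 61a.  The single-box inequalities A1 (pivot at the special,
virtual root contracted), A3n (pivot, virtual root free, nested by the replica of the root) and A4n (root-U at the exact level, nested by the state of
the special) are taken as HYPOTHESES in functional form (for real TTSP boxes they are `FK.apUpcCLW_nonneg_of_isTTSP` re-rooted,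
`FK.theta_U_pivot_nested` and root-U — discharged in the bridge file), together with the consistency of every local type.  `thetaPair_Mt_nonneg`:
the nested root functional ♣ = `Mt (thetaPair Y Z)` is nonnegative against every monotone nested nonnegative weight pair — THEOREM G27 of the memo,
proved by regrouping the 40-term certificate of file 61d box by box (`certY_nonneg`, `certZ_nonneg`: for a fixed configuration of the partner the
class indicators are constants and every surviving instance is one hypothesis instance against the weight `β ↦ H_i(β,γ)`) plus the residual table
`Cert.rho_nonneg`.  This is fact 1 of `FK.RootForm.spine_facts` for the base `B_y ∥ B_z`; fact 2 is the same theorem for the pair `(B_y, B_z ∥ g)`.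
[folklore]
-/

noncomputable section

namespace Summit.CriticalPhenomena.PercolationContinuityZ3.Theorems

namespace FK

namespace RootForm

namespace Base

open Finset

/-- Data of a one-special box at a configuration and ONE state of its special: level and the two pole bits. [folklore] -/
structure SDat where
  /-- level (own cycles, both replicas) -/
  L : ℤ
  /-- poles joined in replica 1 -/
  c : Bool
  /-- poles joined in replica 2 -/
  cb : Bool

/-- Data of a one-special box at a configuration: `t0` with the special in replica 2, `t1` with the special in replica 1. [folklore] -/
structure BDat where
  /-- special in replica 2 -/
  t0 : SDat
  /-- special in replica 1 -/
  t1 : SDat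

/-- state selector. [folklore] -/
def BDat.ts (d : BDat) (s : Bool) : SDat := if s then d.t1 else d.t0

/-- the local type of a box datum. [folklore] -/
def BDat.type (d : BDat) : Cert.BT := ⟨d.t0.c, d.t1.c, d.t0.cb, d.t1.cb, d.t1.L - d.t0.L⟩

/-- pattern data of two boxes in parallel between common poles (theta pair). [folklore] -/
def comb (a b : SDat) : PDat := ⟨a.L + b.L + bit (a.c && b.c) + bit (a.cb && b.cb), a.c || b.c, a.cb || b.cb⟩

/-- The environment `B_y ∥ B_z` of two abstract boxes (configurations = pairs). [folklore] -/
def thetaPair {B B' : Type*} (Y : B → BDat) (Z : B' → BDat) : Env (B × B') := fun p =>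
  ⟨comb (Y p.1).t0 (Z p.2).t0, comb (Y p.1).t1 (Z p.2).t0, comb (Y p.1).t0 (Z p.2).t1, comb (Y p.1).t1 (Z p.2).t1⟩

/-- real generator integrand A1 of a box, as the cast of the type-level one at the normalised threshold. [folklore] -/
def gA1 (d : BDat) (K : ℤ) : ℝ := ((Cert.A1 d.type (K - d.t0.L) : ℤ) : ℝ)
/-- see `gA1`. [folklore] -/
def gA3u (d : BDat) (K : ℤ) : ℝ := ((Cert.A3u d.type (K - d.t0.L) : ℤ) : ℝ)
/-- see `gA1`. [folklore] -/
def gA3l (d : BDat) (K : ℤ) : ℝ := ((Cert.A3l d.type (K - d.t0.L) : ℤ) : ℝ)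
/-- see `gA1`. [folklore] -/
def gA4u (d : BDat) (K : ℤ) : ℝ := ((Cert.A4u d.type (K - d.t0.L) : ℤ) : ℝ)
/-- see `gA1`. [folklore] -/
def gA4l (d : BDat) (K : ℤ) : ℝ := ((Cert.A4l d.type (K - d.t0.L) : ℤ) : ℝ)

/-! ### Linking the real integrands of `thetaPair` with the type-level ones -/

/-- the real indicator as a cast of the integer one. [folklore] -/
theorem ind_eq_cast {P Q : Prop} [Decidable P] [Decidable Q] (h : P ↔ Q) : ind P = ((Cert.I Q : ℤ) : ℝ) := by
  unfold ind Cert.I; by_cases hp : P <;> by_cases hq : Q <;> simp_all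
/-- `ind (A ∧ b) = I(A')·bi b`. [folklore] -/
theorem ind_and_eq_cast {P Q : Prop} [Decidable P] [Decidable Q] (h : P ↔ Q) (b : Bool) :
    ind (P ∧ b = true) = ((Cert.I Q * Cert.bi b : ℤ) : ℝ) := by
  unfold ind Cert.I Cert.bi; by_cases hp : P <;> by_cases hq : Q <;> cases b <;> simp_all
/-- `Cert.bi = bit`. [folklore] -/
@[simp] theorem bi_eq_bit (b : Bool) : Cert.bi b = bit b := rfl

/-- level bracket of the pair at states `(s,s')`, replica-1 root. [folklore] -/
theorem a1_link (dy dz : BDat) (s s' : Bool) (J : ℤ) : (comb (dy.ts s) (dz.ts s')).a1 J =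
    ((Cert.I (Cert.plam dy.type dz.type s s' + Cert.C1 dy.type dz.type s s' ≤ J - dz.t0.L - dy.t0.L) : ℤ) : ℝ) := by
  unfold PDat.a1; refine ind_eq_cast ?_
  cases s <;> cases s' <;> simp [comb, BDat.ts, BDat.type, Cert.plam, Cert.lev, Cert.ccB, Cert.cbB, Cert.C1] <;> omega
/-- level bracket of the pair at states `(s,s')`, replica-2 root. [folklore] -/
theorem a2_link (dy dz : BDat) (s s' : Bool) (J : ℤ) : (comb (dy.ts s) (dz.ts s')).a2 J =
    ((Cert.I (Cert.plam dy.type dz.type s s' + Cert.C2 dy.type dz.type s s' ≤ J - dz.t0.L - dy.t0.L) : ℤ) : ℝ) := by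
  unfold PDat.a2; refine ind_eq_cast ?_
  cases s <;> cases s' <;> simp [comb, BDat.ts, BDat.type, Cert.plam, Cert.lev, Cert.ccB, Cert.cbB, Cert.C2] <;> omega
/-- root-exchange bracket of the pair at states `(s,s')`, replica 1. [folklore] -/
theorem r1_link (dy dz : BDat) (s s' : Bool) (J : ℤ) : (comb (dy.ts s) (dz.ts s')).r1 J =
    ((Cert.I (Cert.plam dy.type dz.type s s' = J - dz.t0.L - dy.t0.L) * Cert.C1 dy.type dz.type s s' : ℤ) : ℝ) := by
  have hb : Cert.C1 dy.type dz.type s s' = Cert.bi ((dy.ts s).c || (dz.ts s').c) := by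
    cases s <;> cases s' <;> rfl
  rw [hb]; unfold PDat.r1
  exact ind_and_eq_cast (Q := Cert.plam dy.type dz.type s s' = J - dz.t0.L - dy.t0.L)
    (by cases s <;> cases s' <;> simp [comb, BDat.ts, BDat.type, Cert.plam, Cert.lev, Cert.ccB, Cert.cbB] <;> omega) _
/-- root-exchange bracket of the pair at states `(s,s')`, replica 2. [folklore] -/
theorem r2_link (dy dz : BDat) (s s' : Bool) (J : ℤ) : (comb (dy.ts s) (dz.ts s')).r2 J =
    ((Cert.I (Cert.plam dy.type dz.type s s' = J - dz.t0.L - dy.t0.L) * Cert.C2 dy.type dz.type s s' : ℤ) : ℝ) := by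
  have hb : Cert.C2 dy.type dz.type s s' = Cert.bi ((dy.ts s).cb || (dz.ts s').cb) := by
    cases s <;> cases s' <;> rfl
  rw [hb]; unfold PDat.r2
  exact ind_and_eq_cast (Q := Cert.plam dy.type dz.type s s' = J - dz.t0.L - dy.t0.L)
    (by cases s <;> cases s' <;> simp [comb, BDat.ts, BDat.type, Cert.plam, Cert.lev, Cert.ccB, Cert.cbB] <;> omega) _

/-- The slot-1 integrand of `thetaPair` is the cast of the type-level `X1` at `k = J − L⁰_z − L⁰_y`. [folklore] -/
theorem slot1_link {B B' : Type*} (Y : B → BDat) (Z : B' → BDat) (p : B × B') (J : ℤ) :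
    (thetaPair Y Z p).slot1 J = ((Cert.X1 (Y p.1).type (Z p.2).type (J - (Z p.2).t0.L - (Y p.1).t0.L) : ℤ) : ℝ) := by
  have e0 : (thetaPair Y Z p).d0 = comb ((Y p.1).ts false) ((Z p.2).ts false) := rfl
  have ey : (thetaPair Y Z p).dy = comb ((Y p.1).ts true) ((Z p.2).ts false) := rfl
  have ez : (thetaPair Y Z p).dz = comb ((Y p.1).ts false) ((Z p.2).ts true) := rfl
  have eyz : (thetaPair Y Z p).dyz = comb ((Y p.1).ts true) ((Z p.2).ts true) := rfl
  simp only [EDat.slot1, e0, ey, ez, eyz, a1_link, r1_link, Cert.X1]; push_cast; ring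
/-- see `slot1_link`. [folklore] -/
theorem slot0_link {B B' : Type*} (Y : B → BDat) (Z : B' → BDat) (p : B × B') (J : ℤ) :
    (thetaPair Y Z p).slot0 J = ((Cert.X0 (Y p.1).type (Z p.2).type (J - (Z p.2).t0.L - (Y p.1).t0.L) : ℤ) : ℝ) := by
  have e0 : (thetaPair Y Z p).d0 = comb ((Y p.1).ts false) ((Z p.2).ts false) := rfl
  have ey : (thetaPair Y Z p).dy = comb ((Y p.1).ts true) ((Z p.2).ts false) := rfl
  have ez : (thetaPair Y Z p).dz = comb ((Y p.1).ts false) ((Z p.2).ts true) := rfl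
  have eyz : (thetaPair Y Z p).dyz = comb ((Y p.1).ts true) ((Z p.2).ts true) := rfl
  simp only [EDat.slot0, e0, ey, ez, eyz, a2_link, r2_link, Cert.X0]; push_cast; ring

/-! ### The two halves of the certificate are nonnegative -/

section Halves

variable {B B' : Type*} [Fintype B] [Fintype B'] [Preorder B] [Preorder B']

omit [Fintype B] [Fintype B'] in
/-- sections `β ↦ H (β, γ)` of a monotone weight are monotone. [folklore] -/
theorem mono_left {H : B × B' → ℝ} (hH : Monotone H) (γ : B') : Monotone fun β => H (β, γ) :=
  fun _ _ h => hH (Prod.mk_le_mk.2 ⟨h, le_rfl⟩)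
omit [Fintype B] [Fintype B'] in
/-- sections `γ ↦ H (β, γ)` of a monotone weight are monotone. [folklore] -/
theorem mono_right {H : B × B' → ℝ} (hH : Monotone H) (β : B) : Monotone fun γ => H (β, γ) :=
  fun _ _ h => hH (Prod.mk_le_mk.2 ⟨le_rfl, h⟩)

omit [Fintype B'] in
/-- **The `y`-half of the certificate is nonnegative**: for a fixed `z`-configuration the class indicators are constants and each
surviving instance is a single-box inequality of `B_y` against the weight `β ↦ H_i(β,γ)`. [folklore] -/
theorem certY_nonneg (Y : B → BDat) (Z : B' → BDat)
    (hA1 : ∀ h : B → ℝ, Monotone h → (∀ β, 0 ≤ h β) → ∀ K : ℤ, 0 ≤ ∑ β, h β * gA1 (Y β) K)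
    (hA3 : ∀ h0 h1 : B → ℝ, Monotone h0 → Monotone h1 → (∀ β, 0 ≤ h0 β) → (∀ β, h0 β ≤ h1 β) → ∀ K : ℤ,
      0 ≤ ∑ β, (h1 β * gA3u (Y β) K + h0 β * gA3l (Y β) K))
    (hA4 : ∀ h0 h1 : B → ℝ, Monotone h0 → Monotone h1 → (∀ β, 0 ≤ h0 β) → (∀ β, h0 β ≤ h1 β) → ∀ K : ℤ,
      0 ≤ ∑ β, (h1 β * gA4u (Y β) K + h0 β * gA4l (Y β) K))
    {H0 H1 : B × B' → ℝ} (m0 : Monotone H0) (m1 : Monotone H1) (n0 : ∀ p, 0 ≤ H0 p) (le : ∀ p, H0 p ≤ H1 p) (J : ℤ) (γ : B') :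
    0 ≤ ∑ β, (H1 (β, γ) * ((Cert.certY (Y β).type (Z γ).type ((J - (Z γ).t0.L) - (Y β).t0.L) ((J - (Z γ).t0.L - 1) - (Y β).t0.L)
        ((J - (Z γ).t1.L) - (Y β).t0.L) ((J - (Z γ).t1.L - 1) - (Y β).t0.L)).1 : ℝ)
      + H0 (β, γ) * ((Cert.certY (Y β).type (Z γ).type ((J - (Z γ).t0.L) - (Y β).t0.L) ((J - (Z γ).t0.L - 1) - (Y β).t0.L)
        ((J - (Z γ).t1.L) - (Y β).t0.L) ((J - (Z γ).t1.L - 1) - (Y β).t0.L)).2 : ℝ)) := by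
  have n1 : ∀ p, 0 ≤ H1 p := fun p => (n0 p).trans (le p)
  have i1 : ∀ K, 0 ≤ ∑ β, H1 (β, γ) * gA1 (Y β) K := fun K => hA1 _ (mono_left m1 γ) (fun β => n1 _) K
  have i0 : ∀ K, 0 ≤ ∑ β, H0 (β, γ) * gA1 (Y β) K := fun K => hA1 _ (mono_left m0 γ) (fun β => n0 _) K
  have i3 : ∀ K, 0 ≤ ∑ β, H1 (β, γ) * gA3u (Y β) K + ∑ β, H0 (β, γ) * gA3l (Y β) K := fun K => by
    rw [← Finset.sum_add_distrib]; exact hA3 _ _ (mono_left m0 γ) (mono_left m1 γ) (fun β => n0 _) (fun β => le _) K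
  have i4b : ∀ K, 0 ≤ ∑ β, H1 (β, γ) * gA4u (Y β) K + ∑ β, H1 (β, γ) * gA4l (Y β) K := fun K => by
    rw [← Finset.sum_add_distrib]; exact hA4 _ _ (mono_left m1 γ) (mono_left m1 γ) (fun β => n1 _) (fun β => le_rfl) K
  have i4n : ∀ K, 0 ≤ ∑ β, H1 (β, γ) * gA4u (Y β) K + ∑ β, H0 (β, γ) * gA4l (Y β) K := fun K => by
    rw [← Finset.sum_add_distrib]; exact hA4 _ _ (mono_left m0 γ) (mono_left m1 γ) (fun β => n0 _) (fun β => le _) K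
  have a1 := i1 (J - (Z γ).t0.L); have a2 := i1 (J - (Z γ).t0.L - 1); have a3 := i0 (J - (Z γ).t0.L); have a4 := i0 (J - (Z γ).t0.L - 1)
  have a5 := i3 (J - (Z γ).t0.L); have a6 := i3 (J - (Z γ).t0.L - 1)
  have a7 := i4b (J - (Z γ).t1.L); have a8 := i4b (J - (Z γ).t1.L - 1)
  have a9 := i4n (J - (Z γ).t1.L); have a10 := i4n (J - (Z γ).t0.L - 1); have a11 := i4n (J - (Z γ).t1.L - 1)
  simp only [gA1, gA3u, gA3l, gA4u, gA4l] at a1 a2 a3 a4 a5 a6 a7 a8 a9 a10 a11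
  generalize (Z γ) = d at *
  obtain ⟨⟨L0, c0, cb0⟩, ⟨L1, c1, cb1⟩⟩ := d
  simp only [BDat.type] at *
  cases c0 <;> cases c1 <;> cases cb0 <;> cases cb1 <;>
    simp only [Cert.certY, Cert.isC, Prod.mk.injEq, Bool.false_eq_true, Bool.true_eq_false, and_true, and_false,
      and_self, ite_true, ite_false, zero_mul, one_mul, mul_zero, mul_one, zero_add, add_zero,
      Int.cast_add, Int.cast_mul, Int.cast_zero, Int.cast_ofNat, mul_add, Finset.sum_add_distrib] <;>
    first | positivity | linarith | (simp only [mul_left_comm _ (2:ℝ) _, ← Finset.mul_sum]; linarith)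

omit [Fintype B] in
/-- **The `z`-half of the certificate is nonnegative** (per fixed `y`-configuration). [folklore] -/
theorem certZ_nonneg (Y : B → BDat) (Z : B' → BDat)
    (hB1 : ∀ h : B' → ℝ, Monotone h → (∀ γ, 0 ≤ h γ) → ∀ K : ℤ, 0 ≤ ∑ γ, h γ * gA1 (Z γ) K)
    (hB3 : ∀ h0 h1 : B' → ℝ, Monotone h0 → Monotone h1 → (∀ γ, 0 ≤ h0 γ) → (∀ γ, h0 γ ≤ h1 γ) → ∀ K : ℤ,
      0 ≤ ∑ γ, (h1 γ * gA3u (Z γ) K + h0 γ * gA3l (Z γ) K))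
    (hB4 : ∀ h0 h1 : B' → ℝ, Monotone h0 → Monotone h1 → (∀ γ, 0 ≤ h0 γ) → (∀ γ, h0 γ ≤ h1 γ) → ∀ K : ℤ,
      0 ≤ ∑ γ, (h1 γ * gA4u (Z γ) K + h0 γ * gA4l (Z γ) K))
    {H0 H1 : B × B' → ℝ} (m0 : Monotone H0) (m1 : Monotone H1) (n0 : ∀ p, 0 ≤ H0 p) (le : ∀ p, H0 p ≤ H1 p) (J : ℤ) (β : B) :
    0 ≤ ∑ γ, (H1 (β, γ) * ((Cert.certZ (Y β).type (Z γ).type ((J - (Y β).t0.L) - (Z γ).t0.L) ((J - (Y β).t0.L - 1) - (Z γ).t0.L)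
        ((J - (Y β).t1.L) - (Z γ).t0.L) ((J - (Y β).t1.L - 1) - (Z γ).t0.L)).1 : ℝ)
      + H0 (β, γ) * ((Cert.certZ (Y β).type (Z γ).type ((J - (Y β).t0.L) - (Z γ).t0.L) ((J - (Y β).t0.L - 1) - (Z γ).t0.L)
        ((J - (Y β).t1.L) - (Z γ).t0.L) ((J - (Y β).t1.L - 1) - (Z γ).t0.L)).2 : ℝ)) := by
  have n1 : ∀ p, 0 ≤ H1 p := fun p => (n0 p).trans (le p)
  have i1 : ∀ K, 0 ≤ ∑ γ, H1 (β, γ) * gA1 (Z γ) K := fun K => hB1 _ (mono_right m1 β) (fun γ => n1 _) K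
  have i0 : ∀ K, 0 ≤ ∑ γ, H0 (β, γ) * gA1 (Z γ) K := fun K => hB1 _ (mono_right m0 β) (fun γ => n0 _) K
  have i3 : ∀ K, 0 ≤ ∑ γ, H1 (β, γ) * gA3u (Z γ) K + ∑ γ, H0 (β, γ) * gA3l (Z γ) K := fun K => by
    rw [← Finset.sum_add_distrib]; exact hB3 _ _ (mono_right m0 β) (mono_right m1 β) (fun γ => n0 _) (fun γ => le _) K
  have i4z : ∀ K, 0 ≤ ∑ γ, H0 (β, γ) * gA4u (Z γ) K + ∑ γ, H0 (β, γ) * gA4l (Z γ) K := fun K => by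
    rw [← Finset.sum_add_distrib]; exact hB4 _ _ (mono_right m0 β) (mono_right m0 β) (fun γ => n0 _) (fun γ => le_rfl) K
  have i4n : ∀ K, 0 ≤ ∑ γ, H1 (β, γ) * gA4u (Z γ) K + ∑ γ, H0 (β, γ) * gA4l (Z γ) K := fun K => by
    rw [← Finset.sum_add_distrib]; exact hB4 _ _ (mono_right m0 β) (mono_right m1 β) (fun γ => n0 _) (fun γ => le _) K
  have a1 := i1 (J - (Y β).t1.L); have a2 := i1 (J - (Y β).t1.L - 1); have a3 := i0 (J - (Y β).t1.L); have a4 := i0 (J - (Y β).t1.L - 1)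
  have a5 := i0 (J - (Y β).t0.L)
  have a6 := i3 (J - (Y β).t1.L); have a7 := i3 (J - (Y β).t1.L - 1)
  have a8 := i4z (J - (Y β).t0.L - 1); have a9 := i4n (J - (Y β).t0.L)
  simp only [gA1, gA3u, gA3l, gA4u, gA4l] at a1 a2 a3 a4 a5 a6 a7 a8 a9
  generalize (Y β) = d at *
  obtain ⟨⟨L0, c0, cb0⟩, ⟨L1, c1, cb1⟩⟩ := d
  simp only [BDat.type] at *
  cases c0 <;> cases c1 <;> cases cb0 <;> cases cb1 <;>
    simp only [Cert.certZ, Cert.isC, Prod.mk.injEq, Bool.false_eq_true, Bool.true_eq_false, and_true, and_false,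
      and_self, ite_true, ite_false, zero_mul, one_mul, mul_zero, mul_one, zero_add, add_zero,
      Int.cast_add, Int.cast_mul, Int.cast_zero, Int.cast_ofNat, mul_add, Finset.sum_add_distrib] <;>
    first | positivity | linarith | (simp only [mul_left_comm _ (2:ℝ) _, ← Finset.mul_sum]; linarith)

/-- **THEOREM G27 (abstract form): ♣ ≥ 0.**  For two abstract one-special boxes whose every configuration has a consistent local type and
which satisfy the single-box inequalities A1 (pivot, virtual root contracted), A3n (pivot, root free, nested) and A4n (root-U at exact level,
nested) against monotone nested nonnegative weights, the nested root functional of the pair `B_y ∥ B_z` is nonnegative against every monotone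
nested nonnegative weight pair — the base (B1) of the word theorem `spine_facts`. [folklore] -/
theorem thetaPair_Mt_nonneg (Y : B → BDat) (Z : B' → BDat)
    (hcY : ∀ β, Cert.consistentB (Y β).type = true) (hcZ : ∀ γ, Cert.consistentB (Z γ).type = true)
    (hA1 : ∀ h : B → ℝ, Monotone h → (∀ β, 0 ≤ h β) → ∀ K : ℤ, 0 ≤ ∑ β, h β * gA1 (Y β) K)
    (hA3 : ∀ h0 h1 : B → ℝ, Monotone h0 → Monotone h1 → (∀ β, 0 ≤ h0 β) → (∀ β, h0 β ≤ h1 β) → ∀ K : ℤ,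
      0 ≤ ∑ β, (h1 β * gA3u (Y β) K + h0 β * gA3l (Y β) K))
    (hA4 : ∀ h0 h1 : B → ℝ, Monotone h0 → Monotone h1 → (∀ β, 0 ≤ h0 β) → (∀ β, h0 β ≤ h1 β) → ∀ K : ℤ,
      0 ≤ ∑ β, (h1 β * gA4u (Y β) K + h0 β * gA4l (Y β) K))
    (hB1 : ∀ h : B' → ℝ, Monotone h → (∀ γ, 0 ≤ h γ) → ∀ K : ℤ, 0 ≤ ∑ γ, h γ * gA1 (Z γ) K)
    (hB3 : ∀ h0 h1 : B' → ℝ, Monotone h0 → Monotone h1 → (∀ γ, 0 ≤ h0 γ) → (∀ γ, h0 γ ≤ h1 γ) → ∀ K : ℤ,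
      0 ≤ ∑ γ, (h1 γ * gA3u (Z γ) K + h0 γ * gA3l (Z γ) K))
    (hB4 : ∀ h0 h1 : B' → ℝ, Monotone h0 → Monotone h1 → (∀ γ, 0 ≤ h0 γ) → (∀ γ, h0 γ ≤ h1 γ) → ∀ K : ℤ,
      0 ≤ ∑ γ, (h1 γ * gA4u (Z γ) K + h0 γ * gA4l (Z γ) K))
    {H0 H1 : B × B' → ℝ} (m0 : Monotone H0) (m1 : Monotone H1) (n0 : ∀ p, 0 ≤ H0 p) (le : ∀ p, H0 p ≤ H1 p) (J : ℤ) :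
    0 ≤ Mt (thetaPair Y Z) H0 H1 J := by
  -- pointwise decomposition into the two certificate halves and the residual
  have key : ∀ p : B × B', H1 p * (thetaPair Y Z p).slot1 J + H0 p * (thetaPair Y Z p).slot0 J =
      (H1 p * ((Cert.certY (Y p.1).type (Z p.2).type ((J - (Z p.2).t0.L) - (Y p.1).t0.L) ((J - (Z p.2).t0.L - 1) - (Y p.1).t0.L)
          ((J - (Z p.2).t1.L) - (Y p.1).t0.L) ((J - (Z p.2).t1.L - 1) - (Y p.1).t0.L)).1 : ℝ)
        + H0 p * ((Cert.certY (Y p.1).type (Z p.2).type ((J - (Z p.2).t0.L) - (Y p.1).t0.L) ((J - (Z p.2).t0.L - 1) - (Y p.1).t0.L)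
          ((J - (Z p.2).t1.L) - (Y p.1).t0.L) ((J - (Z p.2).t1.L - 1) - (Y p.1).t0.L)).2 : ℝ))
      + (H1 p * ((Cert.certZ (Y p.1).type (Z p.2).type ((J - (Y p.1).t0.L) - (Z p.2).t0.L) ((J - (Y p.1).t0.L - 1) - (Z p.2).t0.L)
          ((J - (Y p.1).t1.L) - (Z p.2).t0.L) ((J - (Y p.1).t1.L - 1) - (Z p.2).t0.L)).1 : ℝ)
        + H0 p * ((Cert.certZ (Y p.1).type (Z p.2).type ((J - (Y p.1).t0.L) - (Z p.2).t0.L) ((J - (Y p.1).t0.L - 1) - (Z p.2).t0.L)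
          ((J - (Y p.1).t1.L) - (Z p.2).t0.L) ((J - (Y p.1).t1.L - 1) - (Z p.2).t0.L)).2 : ℝ))
      + (H1 p * ((Cert.rho (Y p.1).type (Z p.2).type (J - (Z p.2).t0.L - (Y p.1).t0.L)).1 : ℝ)
        + H0 p * ((Cert.rho (Y p.1).type (Z p.2).type (J - (Z p.2).t0.L - (Y p.1).t0.L)).2 : ℝ)) := by
    intro p
    have hy : Cert.certY (Y p.1).type (Z p.2).type (J - (Z p.2).t0.L - (Y p.1).t0.L) (J - (Z p.2).t0.L - (Y p.1).t0.L - 1)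
        (J - (Z p.2).t0.L - (Y p.1).t0.L - (Z p.2).type.dL) (J - (Z p.2).t0.L - (Y p.1).t0.L - (Z p.2).type.dL - 1)
        = Cert.certY (Y p.1).type (Z p.2).type ((J - (Z p.2).t0.L) - (Y p.1).t0.L) ((J - (Z p.2).t0.L - 1) - (Y p.1).t0.L)
          ((J - (Z p.2).t1.L) - (Y p.1).t0.L) ((J - (Z p.2).t1.L - 1) - (Y p.1).t0.L) := by
      have hd : (Z p.2).type.dL = (Z p.2).t1.L - (Z p.2).t0.L := rfl
      have h2 : J - (Z p.2).t0.L - (Y p.1).t0.L - 1 = (J - (Z p.2).t0.L - 1) - (Y p.1).t0.L := by ring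
      have h3 : J - (Z p.2).t0.L - (Y p.1).t0.L - (Z p.2).type.dL = (J - (Z p.2).t1.L) - (Y p.1).t0.L := by rw [hd]; ring
      have h4 : J - (Z p.2).t0.L - (Y p.1).t0.L - (Z p.2).type.dL - 1 = (J - (Z p.2).t1.L - 1) - (Y p.1).t0.L := by rw [hd]; ring
      rw [h4, h3, h2]
    have hz : Cert.certZ (Y p.1).type (Z p.2).type (J - (Z p.2).t0.L - (Y p.1).t0.L) (J - (Z p.2).t0.L - (Y p.1).t0.L - 1)
        (J - (Z p.2).t0.L - (Y p.1).t0.L - (Y p.1).type.dL) (J - (Z p.2).t0.L - (Y p.1).t0.L - (Y p.1).type.dL - 1)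
        = Cert.certZ (Y p.1).type (Z p.2).type ((J - (Y p.1).t0.L) - (Z p.2).t0.L) ((J - (Y p.1).t0.L - 1) - (Z p.2).t0.L)
          ((J - (Y p.1).t1.L) - (Z p.2).t0.L) ((J - (Y p.1).t1.L - 1) - (Z p.2).t0.L) := by
      have hd : (Y p.1).type.dL = (Y p.1).t1.L - (Y p.1).t0.L := rfl
      have h1 : J - (Z p.2).t0.L - (Y p.1).t0.L = (J - (Y p.1).t0.L) - (Z p.2).t0.L := by ring
      have h2 : J - (Z p.2).t0.L - (Y p.1).t0.L - 1 = (J - (Y p.1).t0.L - 1) - (Z p.2).t0.L := by ring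
      have h3 : J - (Z p.2).t0.L - (Y p.1).t0.L - (Y p.1).type.dL = (J - (Y p.1).t1.L) - (Z p.2).t0.L := by rw [hd]; ring
      have h4 : J - (Z p.2).t0.L - (Y p.1).t0.L - (Y p.1).type.dL - 1 = (J - (Y p.1).t1.L - 1) - (Z p.2).t0.L := by rw [hd]; ring
      rw [h4, h3, h2, h1]
    rw [slot1_link, slot0_link]
    simp only [Cert.rho, hy, hz]
    push_cast; ring
  unfold Mt
  rw [Finset.sum_congr rfl (fun p _ => key p), Finset.sum_add_distrib, Finset.sum_add_distrib]
  refine add_nonneg (add_nonneg ?_ ?_) ?_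
  · rw [Fintype.sum_prod_type_right]
    exact Finset.sum_nonneg fun γ _ => certY_nonneg Y Z hA1 hA3 hA4 m0 m1 n0 le J γ
  · rw [Fintype.sum_prod_type]
    exact Finset.sum_nonneg fun β _ => certZ_nonneg Y Z hB1 hB3 hB4 m0 m1 n0 le J β
  · refine Finset.sum_nonneg fun p _ => ?_
    obtain ⟨h1, h2⟩ := Cert.rho_nonneg (Y p.1).type (Z p.2).type (hcY p.1) (hcZ p.2) (J - (Z p.2).t0.L - (Y p.1).t0.L)
    have h1' : (0 : ℝ) ≤ ((Cert.rho (Y p.1).type (Z p.2).type (J - (Z p.2).t0.L - (Y p.1).t0.L)).1 : ℝ) := by exact_mod_cast h1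
    have h2' : (0 : ℝ) ≤ ((Cert.rho (Y p.1).type (Z p.2).type (J - (Z p.2).t0.L - (Y p.1).t0.L)).1 : ℝ)
        + ((Cert.rho (Y p.1).type (Z p.2).type (J - (Z p.2).t0.L - (Y p.1).t0.L)).2 : ℝ) := by exact_mod_cast h2
    nlinarith [n0 p, le p]

/-! ### The base fact 2: `g ∥ (B_y ∥ B_z) = B_y ∥ (B_z ∥ g)` -/

/-- a fresh parallel free edge on ONE state datum of a box (edge in replica 1 iff `b`). [folklore] -/
def SDat.parS (b : Bool) (a : SDat) : SDat := ⟨a.L + bit (b && a.c) + bit (!b && a.cb), b || a.c, !b || a.cb⟩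

/-- the box `B ∥ g` of an abstract box `B` (configurations `Bool × B'`). [folklore] -/
def parBox (Z : B' → BDat) : Bool × B' → BDat := fun q => ⟨(Z q.2).t0.parS q.1, (Z q.2).t1.parS q.1⟩

omit [Fintype B] [Fintype B'] [Preorder B] [Preorder B'] in
/-- moving the parallel edge into the second box does not change the pattern data. [folklore] -/
theorem comb_parS (a z : SDat) (b : Bool) : comb a (z.parS b) = (comb a z).par b := by
  obtain ⟨L, c, cb⟩ := a; obtain ⟨L', c', cb'⟩ := z
  cases b <;> cases c <;> cases cb <;> cases c' <;> cases cb' <;> simp [comb, SDat.parS, PDat.par] <;> omega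

omit [Fintype B] [Fintype B'] [Preorder B] [Preorder B'] in
/-- `g ∥ (B_y ∥ B_z)` and `B_y ∥ (B_z ∥ g)` have the same data, configuration by configuration. [folklore] -/
theorem thetaPair_parBox (Y : B → BDat) (Z : B' → BDat) (b : Bool) (β : B) (γ : B') :
    thetaPair Y (parBox Z) (β, (b, γ)) = parE (thetaPair Y Z) (b, (β, γ)) := by
  simp only [thetaPair, parBox, parE, EDat.par, comb_parS]

omit [Preorder B] [Preorder B'] in
/-- The nested root functional of `g ∥ (B_y ∥ B_z)` is that of `B_y ∥ (B_z ∥ g)` after reindexing the weights. [folklore] -/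
theorem Mt_parE_thetaPair (Y : B → BDat) (Z : B' → BDat) (H0 H1 : Bool × (B × B') → ℝ) (J : ℤ) :
    Mt (parE (thetaPair Y Z)) H0 H1 J =
      Mt (thetaPair Y (parBox Z)) (fun q => H0 (q.2.1, (q.1, q.2.2))) (fun q => H1 (q.2.1, (q.1, q.2.2))) J := by
  unfold Mt
  refine Fintype.sum_equiv ((Equiv.prodComm Bool (B × B')).trans ((Equiv.prodAssoc B B' Bool).trans
    ((Equiv.refl B).prodCongr (Equiv.prodComm B' Bool)))) _ _ fun p => ?_
  obtain ⟨b, β, γ⟩ := p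
  simp [thetaPair_parBox]

omit [Fintype B] [Fintype B'] in
/-- the reindexing preserves monotonicity. [folklore] -/
theorem mono_reindex {H : Bool × (B × B') → ℝ} (hH : Monotone H) :
    Monotone fun q : B × (Bool × B') => H (q.2.1, (q.1, q.2.2)) := by
  intro p q hpq
  obtain ⟨h1, h2, h3⟩ : p.1 ≤ q.1 ∧ p.2.1 ≤ q.2.1 ∧ p.2.2 ≤ q.2.2 :=
    ⟨(Prod.mk_le_mk.1 hpq).1, (Prod.mk_le_mk.1 (Prod.mk_le_mk.1 hpq).2).1, (Prod.mk_le_mk.1 (Prod.mk_le_mk.1 hpq).2).2⟩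
  exact hH (Prod.mk_le_mk.2 ⟨h2, Prod.mk_le_mk.2 ⟨h1, h3⟩⟩)

/-- **Base fact 2 of the word theorem.**  `M̃_{g ∥ (B_y ∥ B_z)} ≥ 0` against every monotone nested weight pair, from the single-box
inequalities of `B_y` and of the box `B_z ∥ g` (for real boxes all of them kernel theorems). [folklore] -/
theorem thetaPair_parE_Mt_nonneg (Y : B → BDat) (Z : B' → BDat)
    (hcY : ∀ β, Cert.consistentB (Y β).type = true) (hcZ : ∀ q, Cert.consistentB (parBox Z q).type = true)
    (hA1 : ∀ h : B → ℝ, Monotone h → (∀ β, 0 ≤ h β) → ∀ K : ℤ, 0 ≤ ∑ β, h β * gA1 (Y β) K)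
    (hA3 : ∀ h0 h1 : B → ℝ, Monotone h0 → Monotone h1 → (∀ β, 0 ≤ h0 β) → (∀ β, h0 β ≤ h1 β) → ∀ K : ℤ,
      0 ≤ ∑ β, (h1 β * gA3u (Y β) K + h0 β * gA3l (Y β) K))
    (hA4 : ∀ h0 h1 : B → ℝ, Monotone h0 → Monotone h1 → (∀ β, 0 ≤ h0 β) → (∀ β, h0 β ≤ h1 β) → ∀ K : ℤ,
      0 ≤ ∑ β, (h1 β * gA4u (Y β) K + h0 β * gA4l (Y β) K))
    (hB1 : ∀ h : Bool × B' → ℝ, Monotone h → (∀ q, 0 ≤ h q) → ∀ K : ℤ, 0 ≤ ∑ q, h q * gA1 (parBox Z q) K)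
    (hB3 : ∀ h0 h1 : Bool × B' → ℝ, Monotone h0 → Monotone h1 → (∀ q, 0 ≤ h0 q) → (∀ q, h0 q ≤ h1 q) → ∀ K : ℤ,
      0 ≤ ∑ q, (h1 q * gA3u (parBox Z q) K + h0 q * gA3l (parBox Z q) K))
    (hB4 : ∀ h0 h1 : Bool × B' → ℝ, Monotone h0 → Monotone h1 → (∀ q, 0 ≤ h0 q) → (∀ q, h0 q ≤ h1 q) → ∀ K : ℤ,
      0 ≤ ∑ q, (h1 q * gA4u (parBox Z q) K + h0 q * gA4l (parBox Z q) K))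
    {H0 H1 : Bool × (B × B') → ℝ} (m0 : Monotone H0) (m1 : Monotone H1) (n0 : ∀ p, 0 ≤ H0 p) (le : ∀ p, H0 p ≤ H1 p) (J : ℤ) :
    0 ≤ Mt (parE (thetaPair Y Z)) H0 H1 J := by
  rw [Mt_parE_thetaPair]
  exact thetaPair_Mt_nonneg Y (parBox Z) hcY hcZ hA1 hA3 hA4 hB1 hB3 hB4 (mono_reindex m0) (mono_reindex m1)
    (fun q => n0 _) (fun q => le _) J

end Halves

end Base

end RootForm

end FK

end Summit.CriticalPhenomena.PercolationContinuityZ3.Theorems
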